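import Summits.Schanuel.Schanuel.Theorems.RootDecomp1KLogLogCell02

/-!
# RootDecomp1KLogLogCell — lens 1, generation 35 «LOG-LOG CELL of 33364» (RootDecomp1KLogLogCell.lean 05ce2a21…, 1940 l) — continuation (RootDecomp1KLogLogCell03): §4 first half — scale index and factorial bookkeeping (`exists_scale_index`, `factorial_scale_le`, …)

(lens-1 g35 `RootDecomp1KLogLogCell.lean`, sha256 05ce2a21…c847, own farm rc 0 · 0 sorry · axioms std; critic VERDICT STATUS L1698 PORT GO LOW;
port by census-1 gen 15 in eight parts `RootDecomp1KLogLogCell01`–`08` — see the PORT NOTE of part 01; `--supports stmt-Schanuel-33364`; rung 0.)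
-/

noncomputable section

open Complex IntermediateField Polynomial
open Summit.Schanuel.Schanuel.Theorems.RootDecomp1KHyper
open Summit.Schanuel.Schanuel.Theorems.RootDecomp1KHyper.HyperCell
open Summit.Schanuel.Schanuel.Theorems.RootDecomp1KGeneric
open Summit.Schanuel.Schanuel.Theorems.RootDecomp1KRelLiouvilleCell

namespace Summit.Schanuel.Schanuel.Theorems.RootDecomp1KLogLogCell

/-! ## §4  THE INDUCED MEASURE v2: `MvPolyMeasure θ ⇒ LogLogMeasure (ℓ₂, θ)`

`ℓ₂ := Σ_{i ≥ 0} 2^{-i!}` is Mathlib's `liouvilleNumber 2`, `s_N := Σ_{i ≤ N} 2^{-i!} = p_N / 2^{N!}` its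
partial sums (`LiouvilleNumber.partialSum 2 N`); for `N ≥ 2` the numerator `p_N` is ODD, so `p_N / 2^{N!}` is
in lowest terms and the rational-root lemma of §2 applies at the single scale `q = 2^{N!}`.
(The partial-sum lemmas, `norm_sum_sub_sum_le` and `two_mul_prod_le_exp` are g34's, imported from the tree port
`…RootDecomp1KRelLiouvilleCell03`.) -/

section InducedMeasure
open LiouvilleNumber
open scoped Nat

/-- `2^j ≤ (j+1)!`. -/
private theorem two_pow_le_factorial_succ (j : ℕ) : 2 ^ j ≤ (j + 1)! := by
  induction j with
  | zero => simp
  | succ j ih =>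
    rw [pow_succ, Nat.factorial_succ (j + 1)]
    calc 2 ^ j * 2 ≤ (j + 1)! * 2 := Nat.mul_le_mul_right _ ih
      _ ≤ (j + 1)! * (j + 1 + 1) := Nat.mul_le_mul_left _ (by omega)
      _ = (j + 1 + 1) * (j + 1)! := Nat.mul_comm _ _

/-- For `N ≥ 2` the partial sum `s_N` of `ℓ₂` is `p / 2^{N!}` with `p` ODD (and `< 2 · 2^{N!}`). -/
theorem partialSum_two_eq_odd_div {N : ℕ} (hN : 2 ≤ N) :
    ∃ p : ℕ, Odd p ∧ partialSum 2 N = (p : ℝ) / (2 : ℝ) ^ N ! ∧ p < 2 * 2 ^ N ! := by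
  obtain ⟨M, rfl⟩ : ∃ M, N = M + 1 := ⟨N - 1, by omega⟩
  have hM : 1 ≤ M := by omega
  obtain ⟨p₀, hp₀⟩ := partialSum_eq_rat (m := 2) (by norm_num) M
  simp only [Nat.cast_ofNat] at hp₀
  have hfle : M ! ≤ (M + 1)! := Nat.factorial_le (Nat.le_succ M)
  obtain ⟨e, he⟩ : ∃ e, (M + 1)! = M ! + e := ⟨(M + 1)! - M !, by omega⟩
  have he1 : 1 ≤ e := by
    have h1 : (M + 1)! = (M + 1) * M ! := Nat.factorial_succ M
    have h2 : M ! ≤ M * M ! := Nat.le_mul_of_pos_left _ (by omega)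
    have h3 : 1 ≤ M ! := Nat.factorial_pos M
    have h4 : (M + 1) * M ! = M * M ! + M ! := by ring
    omega
  have heq : partialSum 2 (M + 1) = ((p₀ * 2 ^ e + 1 : ℕ) : ℝ) / (2 : ℝ) ^ (M + 1)! := by
    rw [partialSum_succ, hp₀, he, pow_add]
    have h2 : (0 : ℝ) < 2 ^ M ! := by positivity
    have h2e : (0 : ℝ) < 2 ^ e := by positivity
    push_cast
    field_simp
  refine ⟨p₀ * 2 ^ e + 1, Even.add_one ((Nat.even_pow.mpr ⟨even_two, by omega⟩).mul_left p₀),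
    heq, ?_⟩
  have hlt : ((p₀ * 2 ^ e + 1 : ℕ) : ℝ) / 2 ^ (M + 1)! < 2 := by
    rw [← heq]; linarith [partialSum_two_lt_liouvilleNumber (M + 1), liouvilleNumber_two_lt]
  have hpow : (0 : ℝ) < 2 ^ (M + 1)! := by positivity
  rw [div_lt_iff₀ hpow] at hlt
  exact_mod_cast hlt

/-- **The scale index** (v2 bookkeeping, `T log T` instead of g34's `T²`): the least `N ≥ N_d` with
`2^{N!} ≥ Y` has `N! ≤ N_d! + 2 T (1 + log T)`, `T := 2 log Y + 1`.  (`N := max N_d N₀`, `N₀` the first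
index with `2^{N₀!} ≥ Y`; minimality gives `(N₀ - 1)! < T` and `2^{N₀ - 2} ≤ (N₀ - 1)!`, whence
`N₀ ≤ 2 (1 + log T)`.) -/
theorem exists_scale_index (Y : ℝ) (hY : 1 ≤ Y) (Nd : ℕ) :
    ∃ N : ℕ, Nd ≤ N ∧ Y ≤ 2 ^ N ! ∧
      ((N ! : ℕ) : ℝ) ≤ (Nd ! : ℕ) + 2 * (2 * Real.log Y + 1) * (1 + Real.log (2 * Real.log Y + 1)) := by
  classical
  have hex : ∃ N : ℕ, Y ≤ 2 ^ N ! := by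
    refine ⟨⌈Y⌉₊, (Nat.le_ceil Y).trans ?_⟩
    have h1 : (⌈Y⌉₊ : ℝ) ≤ 2 ^ ⌈Y⌉₊ := by exact_mod_cast (Nat.lt_two_pow_self).le
    exact h1.trans (pow_le_pow_right₀ (by norm_num) (Nat.self_le_factorial _))
  have hlogY : 0 ≤ Real.log Y := Real.log_nonneg hY
  set T : ℝ := 2 * Real.log Y + 1 with hT
  have hT1 : 1 ≤ T := by rw [hT]; linarith
  have hT0 : 0 < T := by linarith
  have hlogT : 0 ≤ Real.log T := Real.log_nonneg hT1
  have h2T : 2 ≤ 2 * T * (1 + Real.log T) := by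
    have : 1 ≤ T * (1 + Real.log T) := one_le_mul_of_one_le_of_one_le hT1 (by linarith)
    linarith
  have hNY : Y ≤ 2 ^ (Nat.find hex) ! := Nat.find_spec hex
  have hfact : (((Nat.find hex) ! : ℕ) : ℝ) ≤ 2 * T * (1 + Real.log T) := by
    rcases hk : Nat.find hex with _ | _ | j
    · norm_num [Nat.factorial]; linarith
    · norm_num [Nat.factorial]; linarith
    · have hmin : ¬ (Y ≤ 2 ^ (j + 1)!) := Nat.find_min hex (by rw [hk]; omega)
      push Not at hmin
      have hkf : (((j + 1)! : ℕ) : ℝ) < T := by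
        have h1 : Real.log ((2 : ℝ) ^ (j + 1)!) < Real.log Y :=
          Real.log_lt_log (by positivity) hmin
        rw [Real.log_pow] at h1
        have h2 := Real.log_two_gt_d9
        have h0 : (0 : ℝ) ≤ (((j + 1)! : ℕ) : ℝ) := Nat.cast_nonneg _
        rw [hT]; nlinarith
      have hj2 : (2 : ℝ) ^ j < T := by
        have h1 : ((2 ^ j : ℕ) : ℝ) ≤ (((j + 1)! : ℕ) : ℝ) := by
          exact_mod_cast two_pow_le_factorial_succ j
        push_cast at h1; linarith
      have hjlog : (j : ℝ) * Real.log 2 < Real.log T := by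
        have h1 := Real.log_lt_log (by positivity) hj2
        rwa [Real.log_pow] at h1
      have hjle : (j : ℝ) + 2 ≤ 2 * (1 + Real.log T) := by
        have h2 := Real.log_two_gt_d9
        have hj0 : (0 : ℝ) ≤ j := Nat.cast_nonneg j
        nlinarith
      have hkk0 : (0 : ℝ) ≤ (((j + 1)! : ℕ) : ℝ) := Nat.cast_nonneg _
      rw [Nat.factorial_succ (j + 1)]; push_cast
      calc ((j : ℝ) + 1 + 1) * (((j + 1)! : ℕ) : ℝ) ≤ (2 * (1 + Real.log T)) * T :=
            mul_le_mul (by linarith) hkf.le hkk0 (by positivity)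
        _ = 2 * T * (1 + Real.log T) := by ring
  refine ⟨max Nd (Nat.find hex), le_max_left _ _, ?_, ?_⟩
  · exact hNY.trans (pow_le_pow_right₀ (by norm_num) (Nat.factorial_le (le_max_right _ _)))
  · rcases le_total Nd (Nat.find hex) with h | h
    · rw [max_eq_right h]
      linarith [hfact, (Nat.cast_nonneg (Nd !) : (0 : ℝ) ≤ (Nd ! : ℕ))]
    · rw [max_eq_left h]
      have : (0 : ℝ) ≤ 2 * T * (1 + Real.log T) := by positivity
      linarith

/-- Bookkeeping for the scale: `N! ≤ A₀ · u · v` with `u = 1 + log L`, `v = 1 + log u`. -/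
theorem factorial_scale_le {N Nd : ℕ} {Y cY c₁ u v : ℝ}
    (hNfact : ((N ! : ℕ) : ℝ) ≤
      (Nd ! : ℕ) + 2 * (2 * Real.log Y + 1) * (1 + Real.log (2 * Real.log Y + 1)))
    (hlogY0 : 0 ≤ Real.log Y) (hlogY : Real.log Y ≤ cY * u) (hcY1 : 1 ≤ cY) (hu1 : 1 ≤ u)
    (hc₁ : c₁ = 2 * cY + 1) (hv : v = 1 + Real.log u) :
    ((N ! : ℕ) : ℝ) ≤ (((Nd ! : ℕ) : ℝ) + 2 * c₁ * (1 + Real.log c₁)) * (u * v) := by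
  set T : ℝ := 2 * Real.log Y + 1 with hT
  have hT1 : 1 ≤ T := by rw [hT]; linarith
  have hT0 : 0 < T := by linarith
  have hc₁1 : 1 ≤ c₁ := by rw [hc₁]; linarith
  have hu0 : 0 < u := by linarith
  have hTle : T ≤ c₁ * u := by
    have e : c₁ * u = 2 * (cY * u) + u := by rw [hc₁]; ring
    rw [e, hT]; linarith
  have hlogu : 0 ≤ Real.log u := Real.log_nonneg hu1
  have hlogc₁ : 0 ≤ Real.log c₁ := Real.log_nonneg hc₁1
  have hv1 : 1 ≤ v := by rw [hv]; linarith
  have hlogT : 1 + Real.log T ≤ (1 + Real.log c₁) * v := by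
    have h1 : Real.log T ≤ Real.log (c₁ * u) := Real.log_le_log hT0 hTle
    rw [Real.log_mul (by linarith) hu0.ne'] at h1
    have e : (1 + Real.log c₁) * v =
        1 + Real.log c₁ + Real.log u + Real.log c₁ * Real.log u := by rw [hv]; ring
    rw [e]
    linarith [mul_nonneg hlogc₁ hlogu]
  have hlogT0 : 0 ≤ 1 + Real.log T := by linarith [Real.log_nonneg hT1]
  have h2 : 2 * T * (1 + Real.log T) ≤ 2 * (c₁ * u) * ((1 + Real.log c₁) * v) :=
    mul_le_mul (mul_le_mul_of_nonneg_left hTle (by norm_num)) hlogT hlogT0 (by positivity)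
  have huv1 : 1 ≤ u * v := one_le_mul_of_one_le_of_one_le hu1 hv1
  have h3 : ((Nd ! : ℕ) : ℝ) ≤ ((Nd ! : ℕ) : ℝ) * (u * v) :=
    le_mul_of_one_le_right (Nat.cast_nonneg _) huv1
  calc ((N ! : ℕ) : ℝ) ≤ (Nd ! : ℕ) + 2 * T * (1 + Real.log T) := hNfact
    _ ≤ ((Nd ! : ℕ) : ℝ) * (u * v) + 2 * (c₁ * u) * ((1 + Real.log c₁) * v) := add_le_add h3 h2
    _ = (((Nd ! : ℕ) : ℝ) + 2 * c₁ * (1 + Real.log c₁)) * (u * v) := by ring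

end InducedMeasure

end Summit.Schanuel.Schanuel.Theorems.RootDecomp1KLogLogCell
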